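import Summits.BirchSwinnertonDyer.BirchSwinnertonDyer.Theorems.PrintCf2RamifiedOffTYZSelmerRankOneSevenSplit
import Literature.NumberTheory.EllipticCurves.Smith2016.CongruentNumberGenusDeterminantRowSix
import HarnessLib

/-!
# Crux `PrintCf2.RamifiedOffTYZOfFacts` (stmt-BirchSwinnertonDyer-20509), line `offtyz-v7`, LEAD cycle 9 (cruxlead-20509 g8):
# THE TWO PURE SECTORS OF THE EVEN `s = 1` STRATUM — `n = 2m ≡ 6 (mod 8)` with every odd prime `≡ ±1 (mod 8)`, or every odd prime
# `≡ 1, 3 (mod 8)`: `#Sel₂(E_n) = 8 ⟹ Σ₂'(n)` ODD ⟹ (TYZ's genus door) `ord = rank = 1`, `Ш[2^∞] = 0`, `BSD(E_n, 2)` modulo `tyz_genusPointData`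

THEOREMS ONLY (no `def`, no named fact, no `sorry`), `--supports stmt-BirchSwinnertonDyer-20509` (item 23432's `s = 1`, `n ≡ 6 (8)` stratum — the
part of it that Tian–Yuan–Zhang's own criterion reaches by a CLOSED FORM; the LEAD's pattern census shows the Σ₂′ criterion reaches only ≈ 57 %
of the `s = 1` classes with `n ≡ 6 (8)`, the rest being the object of the even mover programme).

MECHANISM (Smith 2016 row 6, tree theorems `genusSum₂'_two_mul_eq_border_adjugate_six`, `border_adjugate_six_eq_sum_adjugate_inr`):
`Σ₂'(2m) ≡ Σ_j t_j · adj(N₂)_{(inr j)(inr j)}` with `N₂ = bigN a univ t z z = [[D_t, (A + D_z)ᵀ],[A + D_z, D_z]]` (`t = ((−1/pᵢ)₊)`,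
`z = ((2/pᵢ)₊)`), and `rank N₂ = rank M` for Monsky's even matrix (`rank_monskyMatrixEven_eq_rank_bigN`).  If `#Sel₂(E_{2m}) = 8` then
`#ker N₂ = 2` (§1); `N₂` is symmetric, so `adj(N₂)_{αα} = κ_α` for the non-zero kernel vector `κ` (§1).  On the two pure sectors the
kernel vector is EXPLICIT: `z = 0` (all `pᵢ ≡ ±1 (8)`): `κ = (0; 𝟙)` since `𝟙ᵀA = 0` for `m ≡ 3 (mod 4)`; `z = t` (all `pᵢ ≡ 1, 3 (8)`):
`κ = (𝟙; 𝟙)`.  Either way `adj(N₂)_{(inr j)(inr j)} = 1` for every `j` and `Σ₂'(2m) ≡ Σ_j t_j = 1` (§2).  §3 feeds TYZ's GZK-free even genus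
door `P2.rankOne_sha_bsdp_two_congruentNumberCurve_of_selmerEight_six_noGZK`.  The LEAD's census (`census6_sub.py`): 0 exceptions on all
Legendre patterns `k ≤ 5` and random `k = 6` — now theorems for every `k`.  Tian 2014's class-6 family (`2p₀p₁⋯`, `p₀ ≡ 3 (4)`, `pᵢ ≡ 1 (8)`)
is the case of ONE prime `≡ 3 (mod 4)` of either sector.  BSD is not proved by any of this; no class is closed by this file.

References: [cite: Smith2016CongruentDensity, Thm. 2.2 row 6 and §2.2]; [cite: TianYuanZhang2017, Thm. 1.1, Thm. 1.2, Thm. 3.5]; [cite: Tian2014, Thm. 1.3];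
[cite: HeathBrown1994SelmerCongruentII, Appendix (Monsky), typescript p. 41 L20–L36]; [cite: Miller2011LMS, Def. 1.1].
-/

noncomputable section

open scoped Classical

open WeierstrassCurve Matrix Finset Literature.NumberTheory.EllipticCurves Literature.NumberTheory.EllipticCurves.TianYuanZhang2017
  Literature.NumberTheory.EllipticCurves.TianYuanZhang2017.W2
  Literature.NumberTheory.EllipticCurves.HeathBrown1994
  Literature.NumberTheory.EllipticCurves.MonskySelmerParity
  Literature.NumberTheory.EllipticCurves.Smith2016
  Literature.NumberTheory.EllipticCurves.Rank1Residual
  Literature.LinearAlgebra.Matrix Literature.Combinatorics.Enumerative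
  Summit.BirchSwinnertonDyer.PrintCf2.QForm Summit.BirchSwinnertonDyer.PrintCf2.QFormForest

set_option autoImplicit false

namespace Summit.BirchSwinnertonDyer.PrintCf2.MoverAssembly

/-! ## §1 `#Sel₂(E_{2m}) = 8` ⟹ the doubled forest matrix `N₂` has a `2`-element kernel; cofactors of a symmetric matrix with a line kernel -/

section Kernel

variable {k : ℕ} (p : Fin k → ℕ) (hp : ∀ i, (p i).Prime) (hodd : ∀ i, Odd (p i)) (hinj : Function.Injective p)

include hp hodd hinj in
/-- **`#Sel₂(E_{2m}) = 8 ⟹ #ker N₂ = 2`** (`m = p₁⋯p_k`): Monsky's exact even formula gives `s(2m) = 1`, i.e. `rank M = 2k − 1`, and Monsky's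
even matrix has the rank of the doubled forest matrix `N₂ = bigN a univ t z z`.
[cite: HeathBrown1994SelmerCongruentII, Appendix (Monsky), typescript p. 41 L20–L36] [cite: Smith2016CongruentDensity, §2.2 (rank M₁ = rank M)] -/
theorem card_ker_bigN_even_eq_two_of_card_selmer_eight
    (hsel : Nat.card ((congruentNumberCurve (2 * ∏ i, p i)).selmerGroup 2) = 8) :
    Fintype.card {v : Fin k ⊕ Fin k → ZMod 2 //
      bigN (fun i j => legendreMatrix p i j) univ (fun i => addLegendreSym (-1) (p i)) (fun i => addLegendreSym 2 (p i))
        (fun i => addLegendreSym 2 (p i)) *ᵥ v = 0} = 2 := by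
  rw [monsky_card_selmerGroup_two_even_holds k p hp hodd hinj, show (8 : ℕ) = 2 ^ 3 by norm_num] at hsel
  have hs : monskySelmerRankEven p = 1 := by
    have := Nat.pow_right_injective le_rfl hsel; omega
  have hrank : (monskyMatrixEven p).rank ≤ 2 * k := by
    have h := Matrix.rank_le_card_width (monskyMatrixEven p)
    rwa [Fintype.card_sum, Fintype.card_fin, ← two_mul] at h
  rw [card_ker_mulVec_eq_pow, Fintype.card_sum, Fintype.card_fin, ← two_mul, ← rank_monskyMatrixEven_eq_rank_bigN]
  rw [monskySelmerRankEven] at hs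
  rw [show 2 * k - (monskyMatrixEven p).rank = 1 by omega, pow_one]

/-- **Diagonal cofactors of a symmetric matrix over `𝔽₂` with a `2`-element kernel `{0, κ₀}`**: `adj(N)_{αα} = κ₀(α)`.
[cite: HornJohnson2013, §0.8.2 (adjugate of a matrix of rank n − 1)] -/
theorem adjugate_diag_eq_of_card_ker_eq_two {ι : Type*} [Fintype ι] [DecidableEq ι] (N : Matrix ι ι (ZMod 2)) (hN : Nᵀ = N)
    (hcard : Fintype.card {v : ι → ZMod 2 // N *ᵥ v = 0} = 2) {κ₀ : ι → ZMod 2} (hκ : N *ᵥ κ₀ = 0) (hκ0 : κ₀ ≠ 0) (α : ι) :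
    N.adjugate α α = κ₀ α := by
  obtain ⟨hne, hker⟩ := ker_iff_of_card_eq_two N hcard
  have hκeq : κ₀ = QForm.kerSum N := ((hker κ₀).mp hκ).resolve_left hκ0
  have hdet : N.det = 0 := Matrix.exists_mulVec_eq_zero_iff.mp ⟨κ₀, hκ0, hκ⟩
  rw [← kerSum_apply_eq_adjugate N hN hdet α, hκeq]
  rfl

end Kernel

/-! ## §2 The explicit kernel vectors on the two pure sectors, and `Σ₂'(2m)` odd -/

section Pure

variable {k : ℕ} (p : Fin k → ℕ) (hp : ∀ i, (p i).Prime) (hodd : ∀ i, Odd (p i)) (hinj : Function.Injective p)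

include hp hodd hinj in
/-- `N₂ · (0; 𝟙) = 0` when every `(2/pᵢ) = +1` and `m ≡ 3 (mod 4)` (`N₂ = [[D_t, Aᵀ],[A, 0]]`, `𝟙ᵀ A = 0`).
[cite: HeathBrown1994SelmerCongruentII, Appendix (Monsky), typescript p. 39 L34–L41] -/
theorem bigN_even_mulVec_zero_one_eq_zero (h4 : (∏ i, p i) % 4 = 3) (hz : ∀ i, addLegendreSym 2 (p i) = 0) :
    bigN (fun i j => legendreMatrix p i j) univ (fun i => addLegendreSym (-1) (p i)) (fun i => addLegendreSym 2 (p i))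
        (fun i => addLegendreSym 2 (p i)) *ᵥ Sum.elim (0 : Fin k → ZMod 2) (1 : Fin k → ZMod 2) = 0 := by
  have hzf : (fun i => addLegendreSym 2 (p i)) = fun _ => (0 : ZMod 2) := funext hz
  have h1 : (legendreMatrix p)ᵀ *ᵥ (1 : Fin k → ZMod 2) = 0 := by
    rw [mulVec_transpose]; exact one_vecMul_legendreMatrix_of_three_mod_four p hp hodd hinj h4
  rw [bigN_univ_eq_fromBlocks_mark _ (Families.legendreMatrix_apply_self p), hzf, fromBlocks_mulVec, Sum.elim_comp_inl, Sum.elim_comp_inr,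
    diagonal_zero, add_zero, mulVec_zero, zero_add, mulVec_zero, zero_mulVec, add_zero, h1]
  ext x
  rcases x with i | i <;> rfl

include hp hodd hinj in
/-- `N₂ · (𝟙; 𝟙) = 0` when `(2/pᵢ)₊ = (−1/pᵢ)₊` for every `i` (all `pᵢ ≡ 1, 3 (mod 8)`) and `m ≡ 3 (mod 4)`
(`N₂ = [[D_t, (A + D_t)ᵀ],[A + D_t, D_t]]`, `A𝟙 = 0`, `𝟙ᵀA = 0`). [cite: HeathBrown1994SelmerCongruentII, Appendix (Monsky), typescript p. 39 L34–L41] -/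
theorem bigN_even_mulVec_one_one_eq_zero (h4 : (∏ i, p i) % 4 = 3) (hz : ∀ i, addLegendreSym 2 (p i) = addLegendreSym (-1) (p i)) :
    bigN (fun i j => legendreMatrix p i j) univ (fun i => addLegendreSym (-1) (p i)) (fun i => addLegendreSym 2 (p i))
        (fun i => addLegendreSym 2 (p i)) *ᵥ Sum.elim (1 : Fin k → ZMod 2) (1 : Fin k → ZMod 2) = 0 := by
  have hzf : (fun i => addLegendreSym 2 (p i)) = (fun i => addLegendreSym (-1) (p i)) := funext hz
  rw [bigN_univ_eq_fromBlocks_mark _ (Families.legendreMatrix_apply_self p), hzf, fromBlocks_mulVec, Sum.elim_comp_inl, Sum.elim_comp_inr,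
    transpose_add, diagonal_transpose, add_mulVec, add_mulVec, mulVec_transpose, one_vecMul_legendreMatrix_of_three_mod_four p hp hodd hinj h4,
    legendreMatrix_mulVec_one]
  ext x
  rcases x with i | i <;> simp only [Sum.elim_inl, Sum.elim_inr, Pi.add_apply, Pi.zero_apply, CharTwo.add_self_eq_zero, zero_add]

include hp hodd hinj in
/-- **`Σ₂'(2m)` IS ODD when `#Sel₂(E_{2m}) = 8` and every odd prime factor is `≡ ±1 (mod 8)`** (`m = p₁⋯p_k ≡ 3 (mod 4)`): the kernel of `N₂`
is the line through `(0; 𝟙)`, so every root-copy cofactor is `1` and `Σ₂' ≡ Σ_j (−1/p_j)₊ = 1`.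
[cite: Smith2016CongruentDensity, Thm. 2.2 row 6] [cite: TianYuanZhang2017, Thm. 1.2] [cite: HeathBrown1994SelmerCongruentII, Appendix (Monsky), typescript p. 41 L20–L36] -/
theorem odd_genusSum₂'_two_mul_of_selmerEight_of_legendreSym_two_eq_zero (h4 : (∏ i, p i) % 4 = 3)
    (hz : ∀ i, addLegendreSym 2 (p i) = 0) (hsel : Nat.card ((congruentNumberCurve (2 * ∏ i, p i)).selmerGroup 2) = 8) :
    Odd (genusSum₂' (2 * ∏ i, p i) fun d => genusClassNumber (GenusField d)) := by
  have hp2 : ∀ i, p i ≠ 2 := ne_two_of_odd p hodd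
  have hk : 0 < k := pos_of_prod_mod_four_eq_three p h4
  have hκ0 : Sum.elim (0 : Fin k → ZMod 2) (1 : Fin k → ZMod 2) ≠ 0 := by
    intro h
    have := congr_fun h (Sum.inr ⟨0, hk⟩)
    rw [Sum.elim_inr, Pi.one_apply, Pi.zero_apply] at this
    exact one_ne_zero this
  rw [odd_iff_natCast_zmod_two_eq_one, genusSum₂'_two_mul_eq_border_adjugate_six p hp hodd hinj h4, border_adjugate_six_eq_sum_adjugate_inr]
  have hadj : ∀ j, (bigN (fun i j => legendreMatrix p i j) univ (fun i => addLegendreSym (-1) (p i)) (fun i => addLegendreSym 2 (p i))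
      (fun i => addLegendreSym 2 (p i))).adjugate (Sum.inr j) (Sum.inr j) = 1 := fun j =>
    (adjugate_diag_eq_of_card_ker_eq_two _ (bigN_transpose _ _ _ _ _) (card_ker_bigN_even_eq_two_of_card_selmer_eight p hp hodd hinj hsel)
      (bigN_even_mulVec_zero_one_eq_zero p hp hodd hinj h4 hz) hκ0 (Sum.inr j)).trans (by rw [Sum.elim_inr, Pi.one_apply])
  simp only [hadj, mul_one]
  rw [sum_addLegendreSym_neg_one_eq p hp hp2, if_neg (by omega)]

include hp hodd hinj in
/-- **`Σ₂'(2m)` IS ODD when `#Sel₂(E_{2m}) = 8` and every odd prime factor is `≡ 1, 3 (mod 8)`** (`m ≡ 3 (mod 4)`): the kernel of `N₂` is the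
line through `(𝟙; 𝟙)`. [cite: Smith2016CongruentDensity, Thm. 2.2 row 6] [cite: TianYuanZhang2017, Thm. 1.2] [cite: HeathBrown1994SelmerCongruentII, Appendix (Monsky), typescript p. 41 L20–L36] -/
theorem odd_genusSum₂'_two_mul_of_selmerEight_of_legendreSym_two_eq_neg_one (h4 : (∏ i, p i) % 4 = 3)
    (hz : ∀ i, addLegendreSym 2 (p i) = addLegendreSym (-1) (p i))
    (hsel : Nat.card ((congruentNumberCurve (2 * ∏ i, p i)).selmerGroup 2) = 8) :
    Odd (genusSum₂' (2 * ∏ i, p i) fun d => genusClassNumber (GenusField d)) := by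
  have hp2 : ∀ i, p i ≠ 2 := ne_two_of_odd p hodd
  have hk : 0 < k := pos_of_prod_mod_four_eq_three p h4
  have hκ0 : Sum.elim (1 : Fin k → ZMod 2) (1 : Fin k → ZMod 2) ≠ 0 := by
    intro h
    have := congr_fun h (Sum.inr ⟨0, hk⟩)
    rw [Sum.elim_inr, Pi.one_apply, Pi.zero_apply] at this
    exact one_ne_zero this
  rw [odd_iff_natCast_zmod_two_eq_one, genusSum₂'_two_mul_eq_border_adjugate_six p hp hodd hinj h4, border_adjugate_six_eq_sum_adjugate_inr]
  have hadj : ∀ j, (bigN (fun i j => legendreMatrix p i j) univ (fun i => addLegendreSym (-1) (p i)) (fun i => addLegendreSym 2 (p i))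
      (fun i => addLegendreSym 2 (p i))).adjugate (Sum.inr j) (Sum.inr j) = 1 := fun j =>
    (adjugate_diag_eq_of_card_ker_eq_two _ (bigN_transpose _ _ _ _ _) (card_ker_bigN_even_eq_two_of_card_selmer_eight p hp hodd hinj hsel)
      (bigN_even_mulVec_one_one_eq_zero p hp hodd hinj h4 hz) hκ0 (Sum.inr j)).trans (by rw [Sum.elim_inr, Pi.one_apply])
  simp only [hadj, mul_one]
  rw [sum_addLegendreSym_neg_one_eq p hp hp2, if_neg (by omega)]

end Pure

/-! ## §3 Through TYZ's GZK-free even genus door (modulo `tyz_genusPointData` alone) -/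

/-- `(2/q)₊ = (−1/q)₊` for an odd prime `q ≡ 1, 3 (mod 8)`. [cite: HeathBrown1994SelmerCongruentII, Appendix (Monsky), typescript p. 39 L10–L13] -/
theorem addLegendreSym_two_eq_neg_one_of_mod_eight {q : ℕ} (hq : q.Prime) (hq2 : q ≠ 2) (h : q % 8 = 1 ∨ q % 8 = 3) :
    addLegendreSym 2 q = addLegendreSym (-1) q := by
  rw [addLegendreSym_two_of_odd (hq.odd_of_ne_two hq2), addLegendreSym_neg_one_of_odd (hq.odd_of_ne_two hq2)]
  rcases h with h | h
  · rw [if_pos (Or.inl h), if_pos (by omega)]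
  · rw [if_neg (by omega), if_neg (by omega)]

/-- **THE TWO PURE SECTORS OF `n ≡ 6 (mod 8)`, modulo `tyz_genusPointData` alone**: square-free `n ≡ 6 (mod 8)` whose odd prime factors are
either all `≡ ±1 (mod 8)` or all `≡ 1, 3 (mod 8)`, with `#Sel⁽²⁾(E_n/ℚ) = 8` ⟹ `ord_{s=1} L(E_n, s) = 1`, `rank E_n(ℚ) = 1`, `Ш(E_n)[2^∞] = 0`,
`BSD(E_n, 2)` (`Σ₂'(n)` odd by §2, then `P2.rankOne_sha_bsdp_two_congruentNumberCurve_of_selmerEight_six_noGZK`).  Generalises Tian 2014's class-6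
family (one prime `≡ 3 (mod 4)`). [cite: TianYuanZhang2017, Thm. 1.2, Thm. 3.5] [cite: Tian2014, Thm. 1.3] [cite: Smith2016CongruentDensity, Thm. 2.2 row 6]
[cite: Miller2011LMS, Def. 1.1] -/
theorem rankOne_sha_bsdp_two_of_selmerEight_of_tyz_six_pure (hTYZ : tyz_genusPointData)
    {n : ℕ} (hsq : Squarefree n) (h6 : n % 8 = 6)
    (hpure : (∀ q : ℕ, q.Prime → q ∣ n → q ≠ 2 → q % 8 = 1 ∨ q % 8 = 7) ∨ (∀ q : ℕ, q.Prime → q ∣ n → q ≠ 2 → q % 8 = 1 ∨ q % 8 = 3))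
    (hsel : haveI := isElliptic_congruentNumberCurve hsq.ne_zero; Nat.card ((congruentNumberCurve n).selmerGroup 2) = 8) :
    haveI := isElliptic_congruentNumberCurve hsq.ne_zero
    (congruentNumberCurve n).analyticRank = 1 ∧ (congruentNumberCurve n).mordellWeilRank = 1 ∧
      AddCommGroup.primaryComponent (congruentNumberCurve n).sha 2 = ⊥ ∧ BSDp (congruentNumberCurve n) 2 := by
  have heven : Even n := Nat.even_iff.mpr (by omega)
  obtain ⟨k, p, hp, hp2, hinj, hprod⟩ := exists_odd_prime_family_of_squarefree_even hsq heven
  have hpodd : ∀ i, Odd (p i) := fun i => (hp i).odd_of_ne_two (hp2 i)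
  have h4 : (∏ i, p i) % 4 = 3 := by omega
  have hdvd : ∀ i, p i ∣ n := fun i => hprod ▸ (dvd_prod_of_mem p (mem_univ i)).mul_left 2
  have hsel' : Nat.card ((congruentNumberCurve (2 * ∏ i, p i)).selmerGroup 2) = 8 := by rw [hprod]; exact hsel
  have hgen : Odd (genusSum₂' (2 * ∏ i, p i) fun d => genusClassNumber (GenusField d)) := by
    rcases hpure with hz | hzy
    · exact odd_genusSum₂'_two_mul_of_selmerEight_of_legendreSym_two_eq_zero p hp hpodd hinj h4
        (fun i => addLegendreSym_two_eq_zero_of_mod_eight (hpodd i) (hz (p i) (hp i) (hdvd i) (hp2 i))) hsel'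
    · exact odd_genusSum₂'_two_mul_of_selmerEight_of_legendreSym_two_eq_neg_one p hp hpodd hinj h4
        (fun i => addLegendreSym_two_eq_neg_one_of_mod_eight (hp i) (hp2 i) (hzy (p i) (hp i) (hdvd i) (hp2 i))) hsel'
  rw [hprod] at hgen
  exact Rank1Residual.P2.rankOne_sha_bsdp_two_congruentNumberCurve_of_selmerEight_six_noGZK hTYZ hsq h6 hsel hgen

/-- **Isogeny saturation** (𝔅_ram conjuncts 1–3): `BSD(W, 2)` for every globally minimal `W/ℚ` isogenous to a minimal-Selmer `E_n` of the two pure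
even sectors, granted `tyz_genusPointData`, GZK, the entire `L`-function and Cassels' invariance. [cite: MilneADT2006, Thm. I.7.3]
[cite: TianYuanZhang2017, Thm. 1.2 and §3] [cite: Miller2011LMS, Def. 1.1] -/
theorem bsdp_two_of_isIsogenous_selmerEight_six_pure (hTYZ : tyz_genusPointData)
    (hGZK : rank_eq_analyticRank_of_analyticRank_le_one) (hL : hasEntireLFunction_rat) (hCassels : bsdRHS_eq_of_isIsogenous)
    {W : WeierstrassCurve ℚ} [W.IsElliptic] [W.IsGloballyMinimal]
    {n : ℕ} (hsq : Squarefree n) (h6 : n % 8 = 6)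
    (hpure : (∀ q : ℕ, q.Prime → q ∣ n → q ≠ 2 → q % 8 = 1 ∨ q % 8 = 7) ∨ (∀ q : ℕ, q.Prime → q ∣ n → q ≠ 2 → q % 8 = 1 ∨ q % 8 = 3))
    (hsel : haveI := isElliptic_congruentNumberCurve hsq.ne_zero; Nat.card ((congruentNumberCurve n).selmerGroup 2) = 8)
    (hiso : IsIsogenous W (congruentNumberCurve n)) : BSDp W 2 := by
  haveI := isElliptic_congruentNumberCurve hsq.ne_zero
  haveI := isGloballyMinimal_congruentNumberCurve hsq
  obtain ⟨hr1, -, -, h₀⟩ := rankOne_sha_bsdp_two_of_selmerEight_of_tyz_six_pure hTYZ hsq h6 hpure hsel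
  exact Wuthrich2014.bsdp_of_isIsogenous hCassels hiso (hGZK (congruentNumberCurve n) hr1.le).2
    ((congruentNumberCurve n).leadingLCoeff_ne_zero_holds (hL (congruentNumberCurve n))) h₀

end Summit.BirchSwinnertonDyer.PrintCf2.MoverAssembly

end
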